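import Summits.BirchSwinnertonDyer.BirchSwinnertonDyer.Theorems.SchneiderFreeAdditiveX3LeafOnKrizLiLocus
import Summits.BirchSwinnertonDyer.BirchSwinnertonDyer.Theorems.SchneiderFreeAdditiveX3ControlFacts
import Summits.BirchSwinnertonDyer.Rank1Residual.X11b.AnticyclotomicEmbedding
import Summits.BirchSwinnertonDyer.Rank1Residual.X11b.Three.StepLAtThree
import Literature.NumberTheory.EllipticCurves.AnticyclotomicPConverseLinks
import Literature.NumberTheory.EllipticCurves.BSDHeegnerPointsGrossZagierProofs
import Literature.NumberTheory.EllipticCurves.GrossZagierRationalPoint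
import Literature.NumberTheory.EllipticCurves.KrizLi2019.SexticTwistBSDThreeDescent
import Literature.NumberTheory.NumberFields.CongruenceSubgroupTorsionFree
import HarnessLib

/-!
# Route `SchneiderFreeAdditiveX3` (K1 door): the Kriz–Li road to the rung leaf is `L`-VALUE-FREE — on the Kriz–Li locus the leaf's body
# `MissingLowerBoundAt W p` needs, beyond `PrintedFacts` and Kriz–Li 2019 Thm. 1.20, only a Heegner FIELD `K` (odd `d_K`) and Kriz–Li's
# character data with (1)–(4): the Heegner datum `(Dt, H, ι, P)`, the non-torsion of `P` and `L(W^{(d_K)}, 1) ≠ 0` are DERIVED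

Cell `bsd-schneider-ideate`, seat `bsd-schneider-door-c5` (prover, generation 36; leaf load-bearing, `--supports` 19177 as helper).
PARTITION: board row B6 ∩ X3 ∩ sst-twist, `r = 1`, the KRIZ–LI SUB-LOCUS (pairs with Kriz–Li's hypotheses (1)–(3) and a Heegner field with
(4); census of record door-c2 g7, kit j260994: 129 of 7 101 door pairs, 24 of 6 794 at `p = 3`) of `Rank1Residual.partition` — types-the-object-of
nothing new; closes none of B6's cells; BSD NOT advanced; «closes rung: none».  bears_on: K1-door (the rung leaf
`SchneiderFree.AdditiveX3RankOneLower`'s body at these pairs WITHOUT the branch cruxes r2 `PotMultBranchIMC` (19176) / r3 `GordTwoBranchIMC`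
(19177)).

WHY.  Generation 7 of seat `bsd-schneider-door-c2` proved (`missingLowerBoundAt_of_printedFacts_of_pt_of_krizLiDatum`, file
`…LeafOnKrizLiLocus`) the leaf's body at every pair of the door carrying a «Kriz–Li Heegner datum»: a Heegner field `K` of the door (odd `d_K`,
`p ∤ #𝓞_K^×`, Heegner hypothesis for `N_W`, **`L(W^{(d_K)}, 1) ≠ 0`**), a parametrisation datum `Dt`, a Heegner datum `H`, an embedding `ι`,
**the Heegner point `P ∈ W(K)` and its non-torsion**, Kriz–Li's character data `(ψ, ω)` with (1)–(3), the Kronecker character `ε_K` and the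
Bernoulli hypothesis (4).  Of these, the three ANALYTIC/GEOMETRIC conjuncts in bold are OUTPUT, not input, of the published theorems already
on the list — this is Kriz–Li's own «In particular, `P ∈ E(K)` is of infinite order and `E/K` has analytic and algebraic rank 1» (FMS 7 (2019)
Thm. 1.20, p. 8), typed here against the door's vocabulary (the pattern of cell `bsd-print-cfram`'s
`PrintCFram.KrizLiLValueFree.entireLFunction_twist_one_ne_zero_of_thm120`, re-derived in ten lines to keep this file in the door's import cone):
* the datum: `PrintedFacts` carries Heegner points over `K` (`exists_isHeegnerPoint`: `P`, `Dt`, `H`, `ι`); `p ∣ N_W` (additive reduction) and the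
  Heegner hypothesis give `p` split, a degree-one prime `𝔭 ∋ p` and the embedding `X11b.embAt : K ↪ ℚ_p`, and `p ∤ #𝓞_K^×`
  (`X11b.Three.not_dvd_discr_and_not_dvd_torsionOrder_of_heegner`);
* non-torsion: Thm. 1.20 gives `(|W̃^{ns}(𝔽_p)|/p)·log_{ω_W} P ≢ 0 (mod p)`, hence `log_{ω_W} P ≠ 0` (`KrizLi2019.padicLogOmega_ne_zero_of_not_norm_le`),
  and the `ℤ_p`-linear formal logarithm kills torsion (`AcPConverseLinks.padicLogPoint_formalIndex_smul_eq_zero_of_isOfFinAddOrder`);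
* the twist value: Gross–Zagier (`lDerivEK_ne_zero_iff_not_isOfFinAddOrder`: `L'(W/K,1) ≠ 0`), the factorisation
  `L'(W/K, 1) = L'(W, 1)·L(W^{(d_K)}, 1)` at `L(W, 1) = 0` (`KrizLi2019.lDerivEK_eq_deriv_mul`, Artin formalism + modularity) and `r_an(W) = 1`.
Poitou–Tate duality (door-c2's binder `hPT`) is the tree's theorem (`controlFacts_proof`, conjunct (i)).

WHAT.  §1 **`missingLowerBoundAt_of_printedFacts_of_thm120_of_heegnerField`** — for `(W, p)` on the door (`r_an = 1`, `p ≠ 2`, `ClassX3`,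
semistable twist), Kriz–Li's binders `(f, ψ, ω)` with the trace form and (1)–(3), and ANY imaginary quadratic `K` with odd `d_K` satisfying the
Heegner hypothesis for `N_W`, with Kronecker character `ε_K` and (4): **`Typed.MissingLowerBoundAt W p`** (the lower half of BSD_p, the body of
the rung leaf at `(W, p)`).  §2 `additiveX3RankOneLower_onKrizLiField_of_printedFacts_of_thm120` — the same as an implication over all pairs,
the «datum» being purely arithmetic: a Heegner field and character data, NO `L`-value, NO point, NO parametrisation datum.

HONEST FRAMING: CONDITIONAL on the displayed named facts `PrintedFacts` (thirteen published theorems, item 19184) and Kriz–Li 2019 Thm. 1.20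
(`KrizLi2019.thm120_padicLogHeegner_unit_of_bernoulli`, PUBLISHED, refereed); no preprint input, no branch main conjecture; the sub-locus is
thin (Kriz–Li's (2): no split multiplicative prime) and the EXISTENCE of the field `K` with (4) at a given pair is NOT asserted here (at `p = 3`
it is Kriz–Li's Thm. 9.4, a Davenport–Heilbronn-type supply — the next file); nothing is closed; BSD is proved for no curve.
References: Kriz–Li, Forum Math. Sigma 7 (2019) e15, Thm. 1.20 (pp. 7–8) [KrizLi2019]; Gross–Zagier, Invent. Math. 84 (1986) I.(6.3), V.§2
[GrossZagier1986]; Gross 1991 (1.1) [Gross1991]; Jetchev–Skinner–Wan 2017 §7.4.1 [JetchevSkinnerWan2017]; Ireland–Rosen Prop. 20.5.4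
[IrelandRosen1990]; this route p470696 (door-c2 g7), p631092/p631206 (door-c4, `ControlFacts`).
-/

set_option autoImplicit false
-- `Summit.<P>.<Sub>` repeats `BirchSwinnertonDyer` by the tree's layout convention (D-0017)
set_option linter.dupNamespace false

noncomputable section

open scoped Classical

open Field NumberField IsDedekindDomain WeierstrassCurve
open Literature.NumberTheory.EllipticCurves Literature.NumberTheory.EllipticCurves.ModularForms
  Literature.NumberTheory.EllipticCurves.Rank1Residual Literature.NumberTheory.EllipticCurves.Rank1Residual.Typed
  Literature.NumberTheory.EllipticCurves.KrizLi2019 Literature.NumberTheory.GaloisCohomology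
  Summit.BirchSwinnertonDyer.Rank1Residual Summit.BirchSwinnertonDyer.BirchSwinnertonDyer.Theorems.SchneiderFree
  Summit.BirchSwinnertonDyer.BirchSwinnertonDyer.Theses.SchneiderFreeAdditiveX3

namespace Summit.BirchSwinnertonDyer.BirchSwinnertonDyer.Theorems.SchneiderFreeAdditiveX3.KrizLiLocusLValueFree

/-! ### §1 The leaf's body at a pair of the door with Kriz–Li character data and a Heegner FIELD -/

/-- **The lower half of BSD_p at a pair of the K1 door from `PrintedFacts`, Kriz–Li 2019 Thm. 1.20, Kriz–Li's character data and a Heegner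
FIELD — no `L`-value, no Heegner point, no parametrisation datum among the hypotheses.**  For `W/ℚ` globally minimal on the door at an odd
prime `p` (`r_an(W) = 1`, `ClassX3 W p`, semistable twist), Kriz–Li's binders at `(W, p)` (a primitive `ψ` and the Teichmüller `ω` with
`W[p]^{ss} ≅ 𝔽_p(ψ) ⊕ 𝔽_p(ψ⁻¹ω)` in trace form; (1) `ψ(p) ≠ 1`, `(ψ⁻¹ω)(p) ≠ 1`; (2) no split multiplicative prime; (3) at the additive `ℓ ≠ p`),
an imaginary quadratic `K` with `d_K` odd satisfying the Heegner hypothesis for `N_W`, its Kronecker character `ε_K` and (4)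
`B_{1,ψ₀⁻¹ε_K}·B_{1,ψ₀ω⁻¹} ≢ 0 (mod p)`: `MissingLowerBoundAt W p`.  The Heegner point `P ∈ W(K)` with its data comes from `exists_isHeegnerPoint`
(in `PrintedFacts`); `p ∣ N_W` splits in `K`, whence `p ∤ #𝓞_K^×` and the embedding `K ↪ ℚ_p` at a degree-one prime; Thm. 1.20 makes
`log_{ω_W} P ≠ 0`, so `P` is not torsion; Gross–Zagier gives `L'(W/K, 1) ≠ 0`, and `L'(W/K,1) = L'(W,1)·L(W^{(d_K)},1)` gives `L(W^{(d_K)}, 1) ≠ 0`;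
then door-c2's `missingLowerBoundAt_of_printedFacts_of_pt_of_krizLiDatum` (Poitou–Tate from `controlFacts_proof`).  CONDITIONAL on `hF`, `hKL`.
[cite: KrizLi2019, Thm. 1.20 (pp. 7–8: "In particular, P ∈ E(K) is of infinite order and E/K has analytic and algebraic rank 1")]
[cite: Gross1991, (1.1)] [cite: GrossZagier1986, Thm. I.(6.3) and V.§2] [cite: JetchevSkinnerWan2017, §7.4.1 (arXiv:1512.06894 p. 30)] -/
theorem missingLowerBoundAt_of_printedFacts_of_thm120_of_heegnerField (hF : PrintedFacts)
    (hKL : KrizLi2019.thm120_padicLogHeegner_unit_of_bernoulli)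
    (W : WeierstrassCurve ℚ) [W.IsElliptic] [W.IsGloballyMinimal] (p : ℕ) [Fact p.Prime]
    (hr : W.analyticRank = 1) (hp2 : p ≠ 2) (hX : ClassX3 W p) (hS : Additive.SubSemistableTwist W p)
    -- Kriz–Li's binders at `(W, p)`
    (f : ℕ) [NeZero f] (ψ : DirichletCharacter ℚ_[p] f) (ω : DirichletCharacter ℚ_[p] p)
    (hψ : ψ.IsPrimitive) (hω : KrizLi2019.IsTeichmullerCharacter ω)
    (hss : ∀ ℓ : ℕ, ℓ.Prime → ¬ (ℓ ∣ p * W.conductorNorm ℤ) →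
      ‖((W.LFunction ℓ : ℤ) : ℚ_[p]) -
          (ψ (ℓ : ZMod f) + ψ⁻¹ (ℓ : ZMod f) * ω (ℓ : ZMod p))‖ < 1)
    (h1 : ψ (p : ZMod f) ≠ 1) (h1' : KrizLi2019.primVal (KrizLi2019.invMulOmega ψ ω) p ≠ 1)
    (h2 : ∀ ℓ : ℕ, (hℓ : ℓ.Prime) →
      ¬ (haveI := Fact.mk hℓ; W.HasSplitMultiplicativeReductionAtPrime ℓ))
    (h3 : ∀ ℓ : ℕ, (hℓ : ℓ.Prime) → ℓ ≠ p →
      (haveI := Fact.mk hℓ;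
        ¬ W.HasGoodReductionAtPrime ℓ ∧ ¬ W.HasMultiplicativeReductionAtPrime ℓ) →
      ψ (ℓ : ZMod f) ≠ 1 ∧ KrizLi2019.primVal (KrizLi2019.invMulOmega ψ ω) ℓ ≠ 1)
    -- a Heegner FIELD of `W` with odd discriminant, its Kronecker character, and Kriz–Li's (4)
    (K : Type) [Field K] [NumberField K] (hK : IsImaginaryQuadratic K) (hodd : Odd (NumberField.discr K))
    (hHe : SatisfiesHeegnerHypothesis (W.conductorNorm ℤ) K)
    (εK : DirichletCharacter ℚ_[p] (NumberField.discr K).natAbs)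
    (hεK : KrizLi2019.IsKroneckerCharacterOf K εK)
    (h4 : ¬ (‖KrizLi2019.bernoulliOnePrim (KrizLi2019.bernoulliCharOne ψ εK) *
        KrizLi2019.bernoulliOnePrim (KrizLi2019.bernoulliCharTwo ψ εK ω)‖ ≤ (p : ℝ)⁻¹)) :
    MissingLowerBoundAt W p := by
  have hp : p.Prime := Fact.out
  obtain ⟨hGZ, -, -, hmod, -, -, -, -, -, hHP, -, -, -⟩ := id hF
  haveI hN0 : NeZero (W.conductorNorm ℤ) := ⟨W.conductorNorm_pos_holds.ne'⟩
  -- `p ∣ N_W` (additive at `p`), so `p` splits in `K`: `p ∤ #𝓞_K^×`, a degree-one prime, the embedding `K ↪ ℚ_p`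
  have hpN : p ∣ W.conductorNorm ℤ := (W.dvd_conductorNorm_iff_not_hasGoodReductionAtPrime p).mpr hX.2.1
  have hunit : ¬ p ∣ Units.torsionOrder K :=
    (X11b.Three.not_dvd_discr_and_not_dvd_torsionOrder_of_heegner hK hHe hp2 hpN).2
  have hsplit : ((Ideal.span {(p : ℤ)}).primesOver (𝓞 K)).ncard = 2 := hHe p hp hpN
  obtain ⟨𝔭, h𝔭, he, hf⟩ := X11b.exists_degreeOnePrime_of_splitsIn K p hK.1 hsplit
  haveI : NeZero (NumberField.discr K).natAbs := ⟨Int.natAbs_ne_zero.mpr (NumberField.discr_ne_zero K)⟩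
  -- the Heegner point over `K` and its data (`exists_isHeegnerPoint`, in `PrintedFacts`)
  obtain ⟨P, Dt, H, ι, hP⟩ := hHP W K hK hHe
  -- Kriz–Li Thm. 1.20: the normalised logarithm of `P` is a unit, so `log_{ω_W} P ≠ 0` and `P` is not torsion
  have hne := hKL p hp2 W f ψ ω hψ hω hss h1 h1' h2 h3 Dt K hK hHe hsplit εK hεK H ι (X11b.embAt K p 𝔭 h𝔭 he hf) P hP h4
  have hlog := KrizLi2019.padicLogOmega_ne_zero_of_not_norm_le hne
  have hnt : ¬ IsOfFinAddOrder P := fun htor ↦ hlog (by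
    unfold Castella2018.padicLogOmega
    rw [AcPConverseLinks.padicLogPoint_formalIndex_smul_eq_zero_of_isOfFinAddOrder W p _ htor, zero_div])
  -- Gross–Zagier: `L'(W/K, 1) ≠ 0`; the factorisation at `L(W, 1) = 0`: `L(W^{(d_K)}, 1) ≠ 0`
  have hLK : LDerivEK W K ≠ 0 :=
    (lDerivEK_ne_zero_iff_not_isOfFinAddOrder W (W.conductorNorm ℤ) K (hGZ _ W K) hK hHe ⟨Dt, H, ι, hP⟩).mpr hnt
  have hL0 : W.entireLFunction 1 = 0 := entireLFunction_one_eq_zero_of_analyticRank_eq_one hr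
  have hLt : (W.quadraticTwist (NumberField.discr K : ℚ)).entireLFunction 1 ≠ 0 := by
    rw [lDerivEK_eq_deriv_mul W K hmod hL0] at hLK
    exact (mul_ne_zero_iff.mp hLK).2
  -- door-c2's per-datum theorem, Poitou–Tate duality being the tree's theorem
  exact missingLowerBoundAt_of_printedFacts_of_pt_of_krizLiDatum hF controlFacts_proof.1 hKL W p hr hp2 hX hS
    (W.conductorNorm ℤ) K Dt H ι P rfl hK hodd hunit hHe hLt hP hnt f ψ ω hψ hω hss h1 h1' h2 h3 εK hεK h4

/-! ### §2 Class level: the «Kriz–Li datum» of the door is a Heegner FIELD plus character data -/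

/-- **The rung leaf ON THE KRIZ–LI LOCUS of the K1 door, arithmetic form.**  From `PrintedFacts` and Kriz–Li 2019 Thm. 1.20: every pair
`(W, p)` of the door's cells (`r_an = 1`, `p ≠ 2`, `ClassX3`, semistable twist) at which there are Kriz–Li character data `(ψ, ω)` with the
trace form and (1)–(3) AND an imaginary quadratic Heegner field `K` of `N_W` with odd `d_K` whose Kronecker character satisfies (4), satisfies
the leaf's body `MissingLowerBoundAt W p`.  Compare door-c2's `additiveX3RankOneLower_onKrizLiLocus_of_printedFacts_of_pt_of_thm120`: its
existential carried `Dt`, `H`, `ι`, `P`, `¬ IsOfFinAddOrder P`, `p ∤ #𝓞_K^×` and `L(W^{(d_K)}, 1) ≠ 0` — all now derived (§1); the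
Poitou–Tate binder is the tree's `controlFacts_proof`.  The remaining per-pair input is purely arithmetic (a field and two Bernoulli numbers);
its existence at every pair of a sub-locus is a Davenport–Heilbronn-type statement (Kriz–Li Thm. 9.4 at `p = 3`), not asserted here.
CONDITIONAL on `hF`, `hKL`; closes nothing by name; BSD is NOT advanced. [cite: KrizLi2019, Thm. 1.20 (pp. 7–8)]
[cite: JetchevSkinnerWan2017, §7.4.1 (arXiv:1512.06894 p. 30)] -/
theorem additiveX3RankOneLower_onKrizLiField_of_printedFacts_of_thm120 (hF : PrintedFacts)
    (hKL : KrizLi2019.thm120_padicLogHeegner_unit_of_bernoulli) :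
    ∀ (W : WeierstrassCurve ℚ) [W.IsElliptic] [W.IsGloballyMinimal] (p : ℕ) [Fact p.Prime],
      W.analyticRank = 1 → p ≠ 2 → ClassX3 W p → Additive.SubSemistableTwist W p →
      -- «`(W, p)` has Kriz–Li character data and a Heegner field with (4)»
      (∃ (f : ℕ) (_ : NeZero f) (ψ : DirichletCharacter ℚ_[p] f) (ω : DirichletCharacter ℚ_[p] p)
          (K : Type) (_ : Field K) (_ : NumberField K) (εK : DirichletCharacter ℚ_[p] (NumberField.discr K).natAbs),
        ψ.IsPrimitive ∧ KrizLi2019.IsTeichmullerCharacter ω ∧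
        (∀ ℓ : ℕ, ℓ.Prime → ¬ (ℓ ∣ p * W.conductorNorm ℤ) →
          ‖((W.LFunction ℓ : ℤ) : ℚ_[p]) -
              (ψ (ℓ : ZMod f) + ψ⁻¹ (ℓ : ZMod f) * ω (ℓ : ZMod p))‖ < 1) ∧
        ψ (p : ZMod f) ≠ 1 ∧ KrizLi2019.primVal (KrizLi2019.invMulOmega ψ ω) p ≠ 1 ∧
        (∀ ℓ : ℕ, (hℓ : ℓ.Prime) →
          ¬ (haveI := Fact.mk hℓ; W.HasSplitMultiplicativeReductionAtPrime ℓ)) ∧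
        (∀ ℓ : ℕ, (hℓ : ℓ.Prime) → ℓ ≠ p →
          (haveI := Fact.mk hℓ;
            ¬ W.HasGoodReductionAtPrime ℓ ∧ ¬ W.HasMultiplicativeReductionAtPrime ℓ) →
          ψ (ℓ : ZMod f) ≠ 1 ∧ KrizLi2019.primVal (KrizLi2019.invMulOmega ψ ω) ℓ ≠ 1) ∧
        IsImaginaryQuadratic K ∧ Odd (NumberField.discr K) ∧ SatisfiesHeegnerHypothesis (W.conductorNorm ℤ) K ∧
        KrizLi2019.IsKroneckerCharacterOf K εK ∧
        ¬ (‖KrizLi2019.bernoulliOnePrim (KrizLi2019.bernoulliCharOne ψ εK) *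
            KrizLi2019.bernoulliOnePrim (KrizLi2019.bernoulliCharTwo ψ εK ω)‖ ≤ (p : ℝ)⁻¹)) →
      MissingLowerBoundAt W p := by
  intro W _ _ p _ hr hp2 hX hS hdat
  obtain ⟨f, _, ψ, ω, K, _, _, εK, hψ, hω, hss, h1, h1', h2, h3, hK, hodd, hHe, hεK, h4⟩ := hdat
  exact missingLowerBoundAt_of_printedFacts_of_thm120_of_heegnerField hF hKL W p hr hp2 hX hS f ψ ω hψ hω hss h1 h1' h2 h3
    K hK hodd hHe εK hεK h4

end Summit.BirchSwinnertonDyer.BirchSwinnertonDyer.Theorems.SchneiderFreeAdditiveX3.KrizLiLocusLValueFree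

end
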